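import Mathlib
import Literature.Analysis.Complex.LaplaceHalfLine
import Summits.AnomalousDissipation.AnomalousDissipation.Theorems.SoloBlindLaplaceOfExp
import Summits.AnomalousDissipation.AnomalousDissipation.Theorems.SoloBlindNumericalAbscissa

/-!
# Solo-blind kernel #275 — weighted numerical abscissa (similarity) ⇒ semigroup growth bound

Kernel #274 with a WEIGHT.  The frozen chain generator `J` (ENGINE-L-SPEC §0) has one-directional
couplings (`s_m → r_{m±1}`), so its plain numerical abscissa is `O(1)`; a diagonal re-weighting `S`
shrinks them at the price of a condition number — and the condition number only enters the constant
`K`, which the [A′](a) inequality (#266/#273) does not see.  Statement: for bounded `A, S, T` on a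
complex Hilbert space with `T ∘ S = id` (bounded left inverse) and the WEIGHTED one-sided estimate
`Re ⟪S(Aw), Sw⟫ ≤ μ ‖Sw‖²` for all `w` (= numerical abscissa of `S A S⁻¹` at most `μ`):
`‖S e^{tA} v‖ ≤ e^{μt}‖Sv‖`, `‖e^{tA} v‖ ≤ ‖T‖‖S‖ e^{μt}‖v‖`, `‖e^{tA}‖ ≤ (‖T‖‖S‖) e^{μt}` (`t ≥ 0`),
and hence (`laplaceC_readout_of_weighted_abscissa`) the `hK` input of #270 with `K = ‖T‖‖S‖`, `γ = μ`.
Proof: the energy identity for `‖S u(t)‖²` — no conjugation formula for `exp` is needed.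
-/

namespace Summit.AnomalousDissipation.SoloBlind.WeightedAbscissa

open Complex NormedSpace Literature.Analysis.Complex
open Summit.AnomalousDissipation.SoloBlind.LaplaceOfExp
open Summit.AnomalousDissipation.SoloBlind.NumericalAbscissa
open scoped InnerProductSpace

variable {H : Type*} [NormedAddCommGroup H] [InnerProductSpace ℂ H] [CompleteSpace H]

/-- `d/dt (S u(t)) = S (A u(t))` for `u(t) = e^{tA} v`. -/
theorem hasDerivAt_weight_orbit_apply (S A : H →L[ℂ] H) (v : H) (t : ℝ) :
    HasDerivAt (fun τ : ℝ => S (orbit A τ v)) (S (A (orbit A t v))) t := by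
  have h := ((S.restrictScalars ℝ).hasFDerivAt).comp_hasDerivAt t (hasDerivAt_orbit_apply A v t)
  simpa [Function.comp_def] using h

/-- Weighted energy identity: `d/dt ‖S u‖² = 2 Re ⟪S(Au), Su⟫`. -/
theorem hasDerivAt_norm_sq_weight_orbit (S A : H →L[ℂ] H) (v : H) (t : ℝ) :
    HasDerivAt (fun τ : ℝ => ‖S (orbit A τ v)‖ ^ 2)
      (2 * (⟪S (A (orbit A t v)), S (orbit A t v)⟫_ℂ).re) t := by
  have hu := hasDerivAt_weight_orbit_apply S A v t
  have hinner := hu.inner ℂ hu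
  have hre := (Complex.reCLM.hasFDerivAt).comp_hasDerivAt t hinner
  have hfun : (fun τ : ℝ => ‖S (orbit A τ v)‖ ^ 2)
      = (Complex.reCLM : ℂ → ℝ) ∘ fun τ : ℝ => ⟪S (orbit A τ v), S (orbit A τ v)⟫_ℂ := by
    funext τ
    have h := inner_self_eq_norm_sq (𝕜 := ℂ) (S (orbit A τ v))
    simp only [Function.comp_apply, Complex.reCLM_apply]
    simpa using h.symm
  have hsymm : (⟪S (orbit A t v), S (A (orbit A t v))⟫_ℂ).re
      = (⟪S (A (orbit A t v)), S (orbit A t v)⟫_ℂ).re := by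
    have h := inner_re_symm (𝕜 := ℂ) (S (orbit A t v)) (S (A (orbit A t v)))
    simpa using h
  rw [hfun]
  refine hre.congr_deriv ?_
  simp only [Complex.reCLM_apply, Complex.add_re, hsymm]
  ring

/-- **Weighted abscissa, weighted-norm form**: `‖S e^{tA} v‖ ≤ e^{μt} ‖S v‖` for `t ≥ 0`. -/
theorem norm_weight_orbit_apply_le (S A : H →L[ℂ] H) {μ : ℝ}
    (hμ : ∀ w : H, (⟪S (A w), S w⟫_ℂ).re ≤ μ * ‖S w‖ ^ 2) (v : H) {t : ℝ} (ht : 0 ≤ t) :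
    ‖S (orbit A t v)‖ ≤ Real.exp (μ * t) * ‖S v‖ := by
  have hderiv : ∀ τ : ℝ, HasDerivAt (fun τ : ℝ => Real.exp (-2 * μ * τ) * ‖S (orbit A τ v)‖ ^ 2)
      (Real.exp (-2 * μ * τ) * (2 * (⟪S (A (orbit A τ v)), S (orbit A τ v)⟫_ℂ).re
        - 2 * μ * ‖S (orbit A τ v)‖ ^ 2)) τ := by
    intro τ
    have h0 : HasDerivAt (fun τ : ℝ => -2 * μ * τ) (-2 * μ) τ := by
      simpa using (hasDerivAt_id τ).const_mul (-2 * μ)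
    have h1 : HasDerivAt (fun τ : ℝ => Real.exp (-2 * μ * τ)) (Real.exp (-2 * μ * τ) * (-2 * μ)) τ :=
      h0.exp
    exact (h1.mul (hasDerivAt_norm_sq_weight_orbit S A v τ)).congr_deriv (by ring)
  have hψdiff : Differentiable ℝ (fun τ : ℝ => Real.exp (-2 * μ * τ) * ‖S (orbit A τ v)‖ ^ 2) :=
    fun τ => (hderiv τ).differentiableAt
  have hψ' : ∀ τ : ℝ,
      deriv (fun τ : ℝ => Real.exp (-2 * μ * τ) * ‖S (orbit A τ v)‖ ^ 2) τ ≤ 0 := by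
    intro τ
    rw [(hderiv τ).deriv]
    have hle := hμ (orbit A τ v)
    have hinner : 2 * (⟪S (A (orbit A τ v)), S (orbit A τ v)⟫_ℂ).re
        - 2 * μ * ‖S (orbit A τ v)‖ ^ 2 ≤ 0 := by linarith
    exact mul_nonpos_of_nonneg_of_nonpos (Real.exp_pos _).le hinner
  have hanti := antitone_of_deriv_nonpos hψdiff hψ'
  have h0 : Real.exp (-2 * μ * t) * ‖S (orbit A t v)‖ ^ 2 ≤ ‖S v‖ ^ 2 := by
    have h := hanti ht
    simpa [orbit_zero] using h
  have hsq : ‖S (orbit A t v)‖ ^ 2 ≤ (Real.exp (μ * t) * ‖S v‖) ^ 2 := by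
    have hexp : Real.exp (2 * μ * t) * Real.exp (-2 * μ * t) = 1 := by
      have e : 2 * μ * t + -2 * μ * t = 0 := by ring
      rw [← Real.exp_add, e, Real.exp_zero]
    have hsq' : (Real.exp (μ * t)) ^ 2 = Real.exp (2 * μ * t) := by
      rw [sq, ← Real.exp_add]; congr 1; ring
    calc ‖S (orbit A t v)‖ ^ 2
        = Real.exp (2 * μ * t) * (Real.exp (-2 * μ * t) * ‖S (orbit A t v)‖ ^ 2) := by
          rw [← mul_assoc, hexp, one_mul]
      _ ≤ Real.exp (2 * μ * t) * ‖S v‖ ^ 2 := mul_le_mul_of_nonneg_left h0 (Real.exp_pos _).le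
      _ = (Real.exp (μ * t) * ‖S v‖) ^ 2 := by rw [mul_pow, hsq']
  have hnn : 0 ≤ Real.exp (μ * t) * ‖S v‖ := by positivity
  exact (pow_le_pow_iff_left₀ (norm_nonneg _) hnn two_ne_zero).1 hsq

/-- **Weighted abscissa, vector form**: with a bounded left inverse `T` of `S`,
`‖e^{tA} v‖ ≤ ‖T‖‖S‖ e^{μt} ‖v‖`. -/
theorem norm_orbit_apply_le_weighted (S T A : H →L[ℂ] H) (hTS : ∀ w : H, T (S w) = w) {μ : ℝ}
    (hμ : ∀ w : H, (⟪S (A w), S w⟫_ℂ).re ≤ μ * ‖S w‖ ^ 2) (v : H) {t : ℝ} (ht : 0 ≤ t) :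
    ‖orbit A t v‖ ≤ ‖T‖ * ‖S‖ * Real.exp (μ * t) * ‖v‖ := by
  have h1 := norm_weight_orbit_apply_le S A hμ v ht
  have h2 : ‖orbit A t v‖ ≤ ‖T‖ * ‖S (orbit A t v)‖ := by
    have h := T.le_opNorm (S (orbit A t v))
    rwa [hTS] at h
  have h3 : ‖S v‖ ≤ ‖S‖ * ‖v‖ := S.le_opNorm v
  calc ‖orbit A t v‖ ≤ ‖T‖ * ‖S (orbit A t v)‖ := h2
    _ ≤ ‖T‖ * (Real.exp (μ * t) * ‖S v‖) := mul_le_mul_of_nonneg_left h1 (norm_nonneg _)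
    _ ≤ ‖T‖ * (Real.exp (μ * t) * (‖S‖ * ‖v‖)) := by gcongr
    _ = ‖T‖ * ‖S‖ * Real.exp (μ * t) * ‖v‖ := by ring

/-- **Weighted abscissa, operator form**: `‖e^{tA}‖ ≤ (‖T‖‖S‖) e^{μt}` for `t ≥ 0` — the `hK`
of kernel #270 with `K = ‖T‖‖S‖`, `γ = μ`. -/
theorem norm_orbit_le_weighted (S T A : H →L[ℂ] H) (hTS : ∀ w : H, T (S w) = w) {μ : ℝ}
    (hμ : ∀ w : H, (⟪S (A w), S w⟫_ℂ).re ≤ μ * ‖S w‖ ^ 2) :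
    ∀ t : ℝ, 0 ≤ t → ‖orbit A t‖ ≤ ‖T‖ * ‖S‖ * Real.exp (μ * t) := by
  intro t ht
  refine ContinuousLinearMap.opNorm_le_bound _ (by positivity) (fun v => ?_)
  have h := norm_orbit_apply_le_weighted S T A hTS hμ v ht
  linarith [h]

/-- **`𝓛k = R` from a weighted abscissa**: the read-out kernel `t ↦ ℓ(e^{tA} b)` has exponential
order `μ`, and for `Re s > μ` the resolvent element is a unit with `𝓛k(s) = ℓ((s•1−A)⁻¹ b)`. -/
theorem laplaceC_readout_of_weighted_abscissa (S T A : H →L[ℂ] H) (hTS : ∀ w : H, T (S w) = w)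
    {μ : ℝ} (hμ : ∀ w : H, (⟪S (A w), S w⟫_ℂ).re ≤ μ * ‖S w‖ ^ 2)
    (ℓ : (H →L[ℂ] H) →L[ℂ] ℂ) (b : H →L[ℂ] H) :
    HalfLineExpBound (fun t : ℝ => ℓ (orbit A t * b)) (‖ℓ‖ * (‖T‖ * ‖S‖) * ‖b‖) μ ∧
    ∀ z : ℂ, μ < z.re →
      IsUnit (resolventElt z A) ∧ laplaceC (fun t : ℝ => ℓ (orbit A t * b)) z
        = ℓ (Ring.inverse (resolventElt z A) * b) :=
  ⟨halfLineExpBound_readout (norm_orbit_le_weighted S T A hTS hμ) ℓ b,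
   fun _ hz => ⟨isUnit_resolvent (norm_orbit_le_weighted S T A hTS hμ) hz,
     laplaceC_readout (norm_orbit_le_weighted S T A hTS hμ) hz ℓ b⟩⟩

end Summit.AnomalousDissipation.SoloBlind.WeightedAbscissa
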